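import Summits.QuantumFields.YangMills.Theorems.PoincareLipschitzLeungXinBoxCaccioppoli
import Summits.QuantumFields.YangMills.Theorems.PoincareLipschitzLeungXinTwistedGraphStability
import Literature.MathematicalPhysics.QuantumFieldTheory.Balaban1983to89.B10Eq39CollarVolume
import Literature.MathematicalPhysics.QuantumFieldTheory.Balaban1983to89.B3Taylor310LocalRemainder

/-!
# Crux `HistoryTailL` (stmt-QuantumFields-19936), K2 organ of record `hReg` = «LOC-REG-MIN» (route crux `PoincareLipschitz.BlockLipschitzL`,
# stmt-QuantumFields-23533): THE (TWISTED) STABILITY CACCIOPPOLI INEQUALITY ON `ℓ¹` BALLS OF THE TORUS `Site P j` — the tower edition of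
# ✓`…LeungXinBoxCaccioppoli`: cutoff + bond count in the letters the transfer ★w2's `leungXin_inputs_of_orbitMin` delivers (`PBond P j`, `b.src`, `b.tgt`)

Cell `ym3-torus` (YM ladder rung R3 = continuum SU(2) Yang–Mills on the three-torus — a RUNG, NOT the Clay problem: not d = 4, not infinite
volume, not a mass gap), TWIN-WIDTH seat `ym-ust-19936-w7` gen 11 (LEAD `ym-ust-19936-w1` g8 DISPATCH 2026-08-29T04:55:44Z «BOX CUTOFF + TWIST
SIZE — GO»; torus edition offered 05:07:30Z); `--supports stmt-QuantumFields-19936 --as helper`; THEOREMS ONLY, definition-free; every `Params`,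
every level `j`.

WHY.  The direct knit of `hReg`'s stability half runs ON THE LEVEL-`i` TORUS: ★w2-19936 g11's transfer `leungXin_inputs_of_orbitMin` turns
box-ℓ²-orbit minimality of the relative gauge into ★w8-19936 g6's `twisted_graph_stability_frob` hypothesis on `B := ↥S`, `S : Finset (PBond (F.P K) i)`,
`u := v ∘ h`, twists `Sm b` (`Sm b (Sm b)ᵀ = 1`, `‖Sm b − 1‖_F² ≤ 8(dist1 V_b² + dist1 W_b²)`), for EVERY vertex weight `η`; and `hReg`'s regions ∕ radius
guards are `ℓ¹` torus balls (`tdist` of the scaled corners = `Lⁱ·tdist` at level `i`, ✓`PoincareLipschitzHierAlignT3Geometry.tdist_scaled_eq`).  So the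
cutoff lives on `Site P j` with lit ✓`B10Eq39CollarVolume.ball c r = {y | tdist c y ≤ r}` (`#ball ≤ (2r+1)^d`, ✓`card_ball_le`):
`χ(y) := clamp((r + s − tdist c y)∕s)` is `1` on `ball c r`, `0` off `ball c (r+s)`, and `1∕s`-Lipschitz across every bond (`tdist (y+e_μ) y ≤ 1` +
lit ✓`B3Taylor310LocalRemainder.tdist_triangle`); with `#{b ∈ T : b₋ ∈ ball ∨ b₊ ∈ ball} ≤ 2d(2(r+s)+1)^d` this gives, exactly as on `ℤ^d`
(✓`…LeungXinBoxCaccioppoli`, which serves the regularity files on `Zd d`):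
  flat     `Σ_{b ∈ T, b₋, b₊ ∈ ball c r} e_b·(1 + e_b∕2) ≤ 3·(2d(2(r+s)+1)^d)∕s²`            (`stability_caccioppoli_ball`),
  twisted  `Σ_{b ∈ T, b₋, b₊ ∈ ball c r} e_b·(1 + e_b)   ≤ 6·(2d(2(r+s)+1)^d)·(1∕s² + τ²)`   (`twisted_stability_caccioppoli_ball`),
under minimality against the Leung–Xin variations with cutoffs supported in `ball c (r+s)` and, twisted, `‖S_b − 1‖_F² ≤ τ²` on the bonds of `T` with
both ends in `ball c (r+s)`.  At `r = s = R`, `τ² ≲ θ_i²R²` (ball gauge): `E(B_R) ≲ R^{d−2} + θ_i²R^{d+2}`, in tower letters, no `ℤ^d` chart.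

WHAT (ns `…Theorems.PoincareLipschitzLeungXinBallCaccioppoliTorus`).
* §1 `tdist_shift_le_one` (Site `P j`; adapted from lit `B13BlockBondReadingNumerals`' private kernel), `abs_tdist_tgt_sub_tdist_src_le_one`,
  ★`exists_tdist_cutoff` (the clamp cutoff between `ball c r` and `ball c (r+s)`), `card_filter_src_mem_ball_le`, `card_filter_tgt_mem_ball_le`,
  ★`card_touching_ball_le`, ★`sum_sq_sub_tdist_cutoff_le` (capacity over any bond set, `#T`-free).
* §2 ★★★`stability_caccioppoli_ball` (flat), ★★★`twisted_stability_caccioppoli_ball` (twisted, over ★w8's `twisted_graph_stability_frob`).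
HONEST SCOPE.  Cutoff + counting over LEAD's ∕ ★w8's inequalities; nothing of `hReg`∕LOC-REG-MIN, the charts, `BlockLipschitzL`, `HistoryTailL` or any
summit statement is proved; the ball gauge (`τ ≲ θR`) and the energy→range step are NOT here.  YM₃ on T³ is rung R3, NOT the Clay problem.

References: [Xin1980]; T. Kajigaya, Ann. Mat. Pura Appl. (2023) Thm 1.2; [Giaquinta1984] Ch. III §2 p.77; [Balaban1985UV3] p.258; [Balaban1985Averaging] §3.
-/

set_option autoImplicit false

open scoped BigOperators
open Finset Matrix

namespace Summit.QuantumFields.YangMills.Theorems.PoincareLipschitzLeungXinBallCaccioppoliTorus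

open Literature.MathematicalPhysics.QuantumFieldTheory.Balaban1983to89
open Literature.MathematicalPhysics.QuantumFieldTheory.Balaban1983to89.B10Eq39CollarVolume (ball mem_ball card_ball_le)
open Literature.MathematicalPhysics.QuantumFieldTheory.Balaban1983to89.B3Taylor310LocalRemainder (tdist_triangle tdist_comm)
open Summit.QuantumFields.YangMills.Theorems.PoincareLipschitzLeungXinGraphStability (graph_stability)
open Summit.QuantumFields.YangMills.Theorems.PoincareLipschitzLeungXinTwistedGraphStability
  (transpose_mulVec_dot twisted_graph_stability_frob)
open Summit.QuantumFields.YangMills.Theorems.PoincareLipschitzLeungXinBoxCaccioppoli (dot_le_one)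

variable {P : Params} {j : ℕ}

/-! ## §1 Letters: one bond is one step, the clamp cutoff between two balls, the count of bonds touching a ball -/

/-- One lattice step: `|(x + e_μ) − x|₁ ≤ 1` on `Site P j` (adapted from lit `B13BlockBondReadingNumerals`' private `tdist_shift_le_one`). [folklore] -/
theorem tdist_shift_le_one (x : Site P j) (μ : Fin P.d) : Site.tdist (x.shift μ) x ≤ 1 := by
  unfold Site.tdist Site.shift
  have h1 : ∀ ν : Fin P.d,
      min (Function.update x μ (x μ + 1) ν - x ν).val (x ν - Function.update x μ (x μ + 1) ν).val ≤ if ν = μ then 1 else 0 := by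
    intro ν
    by_cases h : ν = μ
    · subst h
      simp only [Function.update_self, add_sub_cancel_left, if_true]
      refine (min_le_left _ _).trans ?_
      rw [ZMod.val_one_eq_one_mod]
      exact Nat.mod_le _ _
    · simp [h]
  calc _ ≤ ∑ ν : Fin P.d, (if ν = μ then 1 else 0) := Finset.sum_le_sum fun ν _ => h1 ν
    _ = 1 := by rw [Finset.sum_ite_eq', if_pos (Finset.mem_univ _)]

/-- Along a bond the `ℓ¹` distance to any centre changes by at most one: `|tdist c b₊ − tdist c b₋| ≤ 1`. [folklore] -/
theorem abs_tdist_tgt_sub_tdist_src_le_one (c : Site P j) (b : PBond P j) :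
    |((Site.tdist c b.tgt : ℕ) : ℝ) - ((Site.tdist c b.src : ℕ) : ℝ)| ≤ 1 := by
  have h1 : Site.tdist c b.tgt ≤ Site.tdist c b.src + 1 := by
    calc Site.tdist c b.tgt ≤ Site.tdist c b.src + Site.tdist b.src b.tgt := tdist_triangle _ _ _
      _ ≤ Site.tdist c b.src + 1 := by
          refine Nat.add_le_add_left ?_ _
          rw [tdist_comm]; exact tdist_shift_le_one b.src b.dir
  have h2 : Site.tdist c b.src ≤ Site.tdist c b.tgt + 1 := by
    calc Site.tdist c b.src ≤ Site.tdist c b.tgt + Site.tdist b.tgt b.src := tdist_triangle _ _ _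
      _ ≤ Site.tdist c b.tgt + 1 := Nat.add_le_add_left (tdist_shift_le_one b.src b.dir) _
  rw [abs_le]
  constructor
  · have : ((Site.tdist c b.src : ℕ) : ℝ) ≤ ((Site.tdist c b.tgt : ℕ) : ℝ) + 1 := by exact_mod_cast h2
    linarith
  · have : ((Site.tdist c b.tgt : ℕ) : ℝ) ≤ ((Site.tdist c b.src : ℕ) : ℝ) + 1 := by exact_mod_cast h1
    linarith

/-- ★ **THE CLAMP CUTOFF BETWEEN TWO `ℓ¹` BALLS OF THE TORUS**: for a centre `c`, radius `r` and width `s ≥ 1` there is `χ : Site P j → [0,1]`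
with `χ = 1` on `ball c r`, `χ = 0` off `ball c (r+s)` (indeed wherever `r + s ≤ tdist c y`), and `|χ b₊ − χ b₋| ≤ 1∕s` on every bond (take
`χ y = clamp((r + s − tdist c y)∕s)`). [folklore] [cite: Giaquinta1984, Ch. III §2 p.77] -/
theorem exists_tdist_cutoff (c : Site P j) (r : ℕ) {s : ℕ} (hs : 1 ≤ s) :
    ∃ χ : Site P j → ℝ, (∀ y, 0 ≤ χ y) ∧ (∀ y, χ y ≤ 1) ∧ (∀ y, Site.tdist c y ≤ r → χ y = 1) ∧
      (∀ y, r + s ≤ Site.tdist c y → χ y = 0) ∧ (∀ b : PBond P j, |χ b.tgt - χ b.src| ≤ 1 / (s : ℝ)) := by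
  have hs0 : (0 : ℝ) < s := by exact_mod_cast hs
  refine ⟨fun y => max 0 (min 1 (((r : ℝ) + s - (Site.tdist c y : ℕ)) / s)), fun y => le_max_left _ _,
    fun y => max_le zero_le_one (min_le_left _ _), fun y hy => ?_, fun y hy => ?_, fun b => ?_⟩
  · beta_reduce
    have h : (1 : ℝ) ≤ ((r : ℝ) + s - (Site.tdist c y : ℕ)) / s := by
      rw [le_div_iff₀ hs0]
      have : ((Site.tdist c y : ℕ) : ℝ) ≤ r := by exact_mod_cast hy
      linarith
    rw [min_eq_left h, max_eq_right zero_le_one]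
  · beta_reduce
    have h : ((r : ℝ) + s - (Site.tdist c y : ℕ)) / s ≤ 0 := by
      refine div_nonpos_of_nonpos_of_nonneg ?_ hs0.le
      have : ((r : ℝ) + s) ≤ ((Site.tdist c y : ℕ) : ℝ) := by exact_mod_cast hy
      linarith
    rw [max_eq_left ((min_le_right _ _).trans h)]
  · -- `clamp` is 1-Lipschitz and its argument moves by at most `1∕s` along a bond
    have hclamp : ∀ p q : ℝ, |max 0 (min 1 p) - max 0 (min 1 q)| ≤ |p - q| := by
      intro p q
      calc |max 0 (min 1 p) - max 0 (min 1 q)| ≤ max |(0 : ℝ) - 0| |min 1 p - min 1 q| := abs_max_sub_max_le_max _ _ _ _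
        _ = |min 1 p - min 1 q| := by rw [sub_self, abs_zero, max_eq_right (abs_nonneg _)]
        _ ≤ max |(1 : ℝ) - 1| |p - q| := abs_min_sub_min_le_max _ _ _ _
        _ = |p - q| := by rw [sub_self, abs_zero, max_eq_right (abs_nonneg _)]
    refine (hclamp _ _).trans ?_
    have e : ((r : ℝ) + s - (Site.tdist c b.tgt : ℕ)) / s - ((r : ℝ) + s - (Site.tdist c b.src : ℕ)) / s =
        -((((Site.tdist c b.tgt : ℕ) : ℝ) - ((Site.tdist c b.src : ℕ) : ℝ)) / s) := by
      rw [← sub_div, ← neg_div]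
      congr 1
      ring
    rw [e, abs_neg, abs_div, abs_of_pos hs0]
    exact div_le_div_of_nonneg_right (abs_tdist_tgt_sub_tdist_src_le_one c b) hs0.le

/-- Bonds of `T` with SOURCE in `ball c ρ` number at most `d·#ball` (they inject into `ball × Fin d`). [folklore] -/
theorem card_filter_src_mem_ball_le [DecidableEq (PBond P j)] (T : Finset (PBond P j)) (c : Site P j) (ρ : ℕ) :
    (T.filter fun b => b.src ∈ ball c ρ).card ≤ (ball c ρ).card * P.d := by
  classical
  calc (T.filter fun b => b.src ∈ ball c ρ).card ≤ ((ball c ρ) ×ˢ (Finset.univ : Finset (Fin P.d))).card := by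
        refine Finset.card_le_card_of_injOn (fun b => (b.src, b.dir)) (fun b hb => ?_) ?_
        · rw [Finset.mem_coe, Finset.mem_filter] at hb
          exact Finset.mem_coe.2 (Finset.mem_product.2 ⟨hb.2, Finset.mem_univ _⟩)
        · intro b _ b' _ h
          obtain ⟨sb, db⟩ := b
          obtain ⟨sb', db'⟩ := b'
          simp only [Prod.mk.injEq] at h
          obtain ⟨h1, h2⟩ := h
          subst h1; subst h2; rfl
    _ = (ball c ρ).card * P.d := by rw [Finset.card_product, Finset.card_univ, Fintype.card_fin]

/-- `x + e_μ` determines `x`: the shift is injective in the site. [folklore] -/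
theorem shift_injective (μ : Fin P.d) : Function.Injective fun x : Site P j => x.shift μ := by
  intro x x' h
  funext k
  have hk := congrFun h k
  by_cases hkμ : k = μ
  · subst hkμ
    simp only [Site.shift, Function.update_self] at hk
    exact add_right_cancel hk
  · simp only [Site.shift, Function.update_of_ne hkμ] at hk
    exact hk

/-- Bonds of `T` with TARGET in `ball c ρ` number at most `d·#ball` (`b ↦ (b₊, dir b)` is injective). [folklore] -/
theorem card_filter_tgt_mem_ball_le [DecidableEq (PBond P j)] (T : Finset (PBond P j)) (c : Site P j) (ρ : ℕ) :
    (T.filter fun b => b.tgt ∈ ball c ρ).card ≤ (ball c ρ).card * P.d := by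
  classical
  calc (T.filter fun b => b.tgt ∈ ball c ρ).card ≤ ((ball c ρ) ×ˢ (Finset.univ : Finset (Fin P.d))).card := by
        refine Finset.card_le_card_of_injOn (fun b => (b.tgt, b.dir)) (fun b hb => ?_) ?_
        · rw [Finset.mem_coe, Finset.mem_filter] at hb
          exact Finset.mem_coe.2 (Finset.mem_product.2 ⟨hb.2, Finset.mem_univ _⟩)
        · intro b _ b' _ h
          obtain ⟨sb, db⟩ := b
          obtain ⟨sb', db'⟩ := b'
          simp only [Prod.mk.injEq] at h
          obtain ⟨h1, h2⟩ := h
          subst h2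
          have h1' : sb.shift db = sb'.shift db := h1
          have hsrc : sb = sb' := shift_injective db h1'
          subst hsrc; rfl
    _ = (ball c ρ).card * P.d := by rw [Finset.card_product, Finset.card_univ, Fintype.card_fin]

/-- ★ **The count of bonds touching an `ℓ¹` ball of the torus**: at most `2d(2ρ+1)^d` bonds of any `T` have an endpoint in `ball c ρ`
(lit ✓`card_ball_le`). [cite: Balaban1985UV3, p.258] -/
theorem card_touching_ball_le [DecidableEq (PBond P j)] (T : Finset (PBond P j)) (c : Site P j) (ρ : ℕ) :
    ((T.filter fun b => b.src ∈ ball c ρ ∨ b.tgt ∈ ball c ρ).card : ℝ) ≤ 2 * (P.d : ℝ) * ((2 * ρ + 1 : ℕ) : ℝ) ^ P.d := by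
  classical
  have hsub : (T.filter fun b => b.src ∈ ball c ρ ∨ b.tgt ∈ ball c ρ) ⊆
      (T.filter fun b => b.src ∈ ball c ρ) ∪ (T.filter fun b => b.tgt ∈ ball c ρ) := by
    intro b hb
    rw [Finset.mem_filter] at hb
    rw [Finset.mem_union, Finset.mem_filter, Finset.mem_filter]
    rcases hb.2 with h | h
    · exact Or.inl ⟨hb.1, h⟩
    · exact Or.inr ⟨hb.1, h⟩
  have h1 := card_filter_src_mem_ball_le T c ρ
  have h2 := card_filter_tgt_mem_ball_le T c ρ
  have hball := card_ball_le c ρ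
  have hcard : (T.filter fun b => b.src ∈ ball c ρ ∨ b.tgt ∈ ball c ρ).card ≤ 2 * ((2 * ρ + 1) ^ P.d * P.d) :=
    (Finset.card_le_card hsub).trans ((Finset.card_union_le _ _).trans (by nlinarith [Nat.mul_le_mul_right P.d hball]))
  have hcast : ((T.filter fun b => b.src ∈ ball c ρ ∨ b.tgt ∈ ball c ρ).card : ℝ) ≤ ((2 * ((2 * ρ + 1) ^ P.d * P.d) : ℕ) : ℝ) := by
    exact_mod_cast hcard
  refine hcast.trans (le_of_eq ?_)
  push_cast; ring

/-- ★ **The capacity of the torus cutoff over a bond set**: for `χ` vanishing off `ball c ρ` with `|χ b₊ − χ b₋| ≤ 1∕s` and weights `w_b ≤ 1`,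
`Σ_{b∈T} w_b·(χ b₋ − χ b₊)² ≤ 2d(2ρ+1)^d ∕ s²` — only bonds touching the ball contribute, `#T` never enters. [cite: Giaquinta1984, Ch. III §2 p.77] -/
theorem sum_sq_sub_tdist_cutoff_le [DecidableEq (PBond P j)] (T : Finset (PBond P j)) (c : Site P j) (ρ : ℕ) {s : ℕ} (hs : 1 ≤ s)
    {χ : Site P j → ℝ} (hout : ∀ y, y ∉ ball c ρ → χ y = 0) (hlip : ∀ b : PBond P j, |χ b.tgt - χ b.src| ≤ 1 / (s : ℝ))
    (w : PBond P j → ℝ) (hw : ∀ b ∈ T, w b ≤ 1) :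
    ∑ b ∈ T, w b * (χ b.src - χ b.tgt) ^ 2 ≤ 2 * (P.d : ℝ) * ((2 * ρ + 1 : ℕ) : ℝ) ^ P.d / (s : ℝ) ^ 2 := by
  classical
  have hs0 : (0 : ℝ) < (s : ℝ) := by exact_mod_cast hs
  rw [← Finset.sum_filter_add_sum_filter_not T (fun b => b.src ∈ ball c ρ ∨ b.tgt ∈ ball c ρ)]
  have hzero : ∑ b ∈ T.filter (fun b => ¬(b.src ∈ ball c ρ ∨ b.tgt ∈ ball c ρ)), w b * (χ b.src - χ b.tgt) ^ 2 = 0 := by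
    refine Finset.sum_eq_zero fun b hb => ?_
    rw [Finset.mem_filter, not_or] at hb
    rw [hout _ hb.2.1, hout _ hb.2.2, sub_zero, zero_pow two_ne_zero, mul_zero]
  rw [hzero, add_zero]
  have hterm : ∀ b ∈ T.filter (fun b => b.src ∈ ball c ρ ∨ b.tgt ∈ ball c ρ), w b * (χ b.src - χ b.tgt) ^ 2 ≤ 1 / (s : ℝ) ^ 2 := by
    intro b hb
    have hb' := (Finset.mem_filter.1 hb).1
    have hsq : (χ b.src - χ b.tgt) ^ 2 ≤ 1 / (s : ℝ) ^ 2 := by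
      have h := hlip b
      rw [abs_sub_comm] at h
      rw [← sq_abs, show (1 : ℝ) / (s : ℝ) ^ 2 = (1 / s) ^ 2 by rw [div_pow, one_pow]]
      exact pow_le_pow_left₀ (abs_nonneg _) h 2
    calc w b * (χ b.src - χ b.tgt) ^ 2 ≤ 1 * (χ b.src - χ b.tgt) ^ 2 := mul_le_mul_of_nonneg_right (hw b hb') (sq_nonneg _)
      _ ≤ 1 / (s : ℝ) ^ 2 := by rw [one_mul]; exact hsq
  calc ∑ b ∈ T.filter (fun b => b.src ∈ ball c ρ ∨ b.tgt ∈ ball c ρ), w b * (χ b.src - χ b.tgt) ^ 2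
      ≤ ∑ _b ∈ T.filter (fun b => b.src ∈ ball c ρ ∨ b.tgt ∈ ball c ρ), 1 / (s : ℝ) ^ 2 := Finset.sum_le_sum hterm
    _ = ((T.filter fun b => b.src ∈ ball c ρ ∨ b.tgt ∈ ball c ρ).card : ℝ) * (1 / (s : ℝ) ^ 2) := by
        rw [Finset.sum_const, nsmul_eq_mul]
    _ ≤ (2 * (P.d : ℝ) * ((2 * ρ + 1 : ℕ) : ℝ) ^ P.d) * (1 / (s : ℝ) ^ 2) :=
        mul_le_mul_of_nonneg_right (card_touching_ball_le T c ρ) (by positivity)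
    _ = 2 * (P.d : ℝ) * ((2 * ρ + 1 : ℕ) : ℝ) ^ P.d / (s : ℝ) ^ 2 := by ring


/-! ## §2 The stability Caccioppoli inequalities on an `ℓ¹` ball of the torus -/

/-- ★★★ **THE STABILITY CACCIOPPOLI INEQUALITY ON A TORUS BALL (flat).**  `T` any finite set of bonds of `Site P j`, `u` unit, centre `c`,
radius `r`, width `s ≥ 1`; if for every cutoff `η` supported in `ball c (r+s)` the Leung–Xin variations (✓`graph_stability`'s `U_t^{a,η}` at
`src∕tgt := b.src∕b.tgt`) do not increase `Σ_{b∈T} u(b₋)·u(b₊)`, then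
`Σ_{b ∈ T, b₋, b₊ ∈ ball c r} e_b·(1 + e_b∕2) ≤ 3·(2d(2(r+s)+1)^d)∕s²`. [cite: Xin1980, p.609–613; Giaquinta1984, Ch. III §2 p.77] -/
theorem stability_caccioppoli_ball [DecidableEq (PBond P j)] (T : Finset (PBond P j)) (u : Site P j → Fin 4 → ℝ)
    (hu : ∀ x, dotProduct (u x) (u x) = 1) (c : Site P j) (r : ℕ) {s : ℕ} (hs : 1 ≤ s)
    (hmin : ∀ η : Site P j → ℝ, (∀ y, y ∉ ball c (r + s) → η y = 0) → ∀ (a : Fin 4) (t : ℝ),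
      ∑ b ∈ T, dotProduct
        ((Real.sqrt (1 + t ^ 2 * dotProduct (η b.src • (Pi.single a 1 - dotProduct (Pi.single a 1) (u b.src) • u b.src))
            (η b.src • (Pi.single a 1 - dotProduct (Pi.single a 1) (u b.src) • u b.src))))⁻¹ •
          (u b.src + t • (η b.src • (Pi.single a 1 - dotProduct (Pi.single a 1) (u b.src) • u b.src))))
        ((Real.sqrt (1 + t ^ 2 * dotProduct (η b.tgt • (Pi.single a 1 - dotProduct (Pi.single a 1) (u b.tgt) • u b.tgt))
            (η b.tgt • (Pi.single a 1 - dotProduct (Pi.single a 1) (u b.tgt) • u b.tgt))))⁻¹ •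
          (u b.tgt + t • (η b.tgt • (Pi.single a 1 - dotProduct (Pi.single a 1) (u b.tgt) • u b.tgt)))) ≤
      ∑ b ∈ T, dotProduct (u b.src) (u b.tgt)) :
    ∑ b ∈ T.filter (fun b => b.src ∈ ball c r ∧ b.tgt ∈ ball c r),
      dotProduct (u b.src - u b.tgt) (u b.src - u b.tgt) * (1 + dotProduct (u b.src - u b.tgt) (u b.src - u b.tgt) / 2) ≤
      3 * (2 * (P.d : ℝ) * ((2 * (r + s) + 1 : ℕ) : ℝ) ^ P.d) / (s : ℝ) ^ 2 := by
  classical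
  obtain ⟨χ, hχ0, hχ1, hχin, hχout, hχlip⟩ := exists_tdist_cutoff c r hs
  have hχout' : ∀ y, y ∉ ball c (r + s) → χ y = 0 := fun y hy => hχout y (by rw [mem_ball, not_le] at hy; omega)
  have hG := graph_stability (B := ↥T) (fun b => b.1.src) (fun b => b.1.tgt) u hu χ (fun a t => by
    have h := hmin χ hχout' a t
    rw [← Finset.sum_coe_sort T] at h
    rw [← Finset.sum_coe_sort T] at h
    exact h)
  rw [Finset.sum_coe_sort T (fun b => χ b.src * χ b.tgt *
      (dotProduct (u b.src - u b.tgt) (u b.src - u b.tgt) * (1 + dotProduct (u b.src - u b.tgt) (u b.src - u b.tgt) / 2))),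
    Finset.sum_coe_sort T (fun b => dotProduct (u b.src) (u b.tgt) * (χ b.src - χ b.tgt) ^ 2)] at hG
  have he0 : ∀ b : PBond P j, 0 ≤ dotProduct (u b.src - u b.tgt) (u b.src - u b.tgt) := fun b => by
    simp only [dotProduct, Pi.sub_apply]
    exact Finset.sum_nonneg fun i _ => mul_self_nonneg _
  have hterm0 : ∀ b : PBond P j, 0 ≤ dotProduct (u b.src - u b.tgt) (u b.src - u b.tgt) *
      (1 + dotProduct (u b.src - u b.tgt) (u b.src - u b.tgt) / 2) := fun b => mul_nonneg (he0 b) (by linarith [he0 b])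
  have hL : ∑ b ∈ T.filter (fun b => b.src ∈ ball c r ∧ b.tgt ∈ ball c r),
      dotProduct (u b.src - u b.tgt) (u b.src - u b.tgt) * (1 + dotProduct (u b.src - u b.tgt) (u b.src - u b.tgt) / 2) ≤
      ∑ b ∈ T, χ b.src * χ b.tgt *
        (dotProduct (u b.src - u b.tgt) (u b.src - u b.tgt) * (1 + dotProduct (u b.src - u b.tgt) (u b.src - u b.tgt) / 2)) := by
    calc ∑ b ∈ T.filter (fun b => b.src ∈ ball c r ∧ b.tgt ∈ ball c r),
          dotProduct (u b.src - u b.tgt) (u b.src - u b.tgt) * (1 + dotProduct (u b.src - u b.tgt) (u b.src - u b.tgt) / 2)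
        = ∑ b ∈ T.filter (fun b => b.src ∈ ball c r ∧ b.tgt ∈ ball c r), χ b.src * χ b.tgt *
            (dotProduct (u b.src - u b.tgt) (u b.src - u b.tgt) * (1 + dotProduct (u b.src - u b.tgt) (u b.src - u b.tgt) / 2)) := by
          refine Finset.sum_congr rfl fun b hb => ?_
          obtain ⟨_, hb1, hb2⟩ := Finset.mem_filter.1 hb
          rw [hχin _ (mem_ball.1 hb1), hχin _ (mem_ball.1 hb2), one_mul, one_mul]
      _ ≤ _ := by
          refine Finset.sum_le_sum_of_subset_of_nonneg (Finset.filter_subset _ T) fun b _ _ => ?_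
          exact mul_nonneg (mul_nonneg (hχ0 _) (hχ0 _)) (hterm0 b)
  have hR : ∑ b ∈ T, dotProduct (u b.src) (u b.tgt) * (χ b.src - χ b.tgt) ^ 2 ≤
      2 * (P.d : ℝ) * ((2 * (r + s) + 1 : ℕ) : ℝ) ^ P.d / (s : ℝ) ^ 2 :=
    sum_sq_sub_tdist_cutoff_le T c (r + s) hs hχout' hχlip (fun b => dotProduct (u b.src) (u b.tgt))
      (fun b _ => dot_le_one (hu _) (hu _))
  calc _ ≤ _ := hL
    _ ≤ 3 * ∑ b ∈ T, dotProduct (u b.src) (u b.tgt) * (χ b.src - χ b.tgt) ^ 2 := hG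
    _ ≤ 3 * (2 * (P.d : ℝ) * ((2 * (r + s) + 1 : ℕ) : ℝ) ^ P.d / (s : ℝ) ^ 2) := by linarith
    _ = 3 * (2 * (P.d : ℝ) * ((2 * (r + s) + 1 : ℕ) : ℝ) ^ P.d) / (s : ℝ) ^ 2 := by ring

/-- ★★★ **THE TWISTED STABILITY CACCIOPPOLI INEQUALITY ON A TORUS BALL.**  As `stability_caccioppoli_ball` with per-bond twists `S_b`
(`S_b S_bᵀ = 1`, acting on the target end by `(S_b)ᵀ`; `e_b = |u(b₋) − (S_b)ᵀu(b₊)|²`): ★w8's twisted `hmin` on `T` for every cutoff supported in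
`ball c (r+s)`, and `‖S_b − 1‖_F² ≤ τ²` on the bonds of `T` with both ends in `ball c (r+s)`, give
`Σ_{b ∈ T, b₋, b₊ ∈ ball c r} e_b·(1 + e_b) ≤ 6·(2d(2(r+s)+1)^d)·(1∕s² + τ²)` — at `r = s = R`, `τ ≍ θ_iR`: `E(B_R) ≲ R^{d−2} + θ_i²R^{d+2}`.
[cite: Xin1980, p.609–613; Kajigaya 2023 Thm 1.2; Giaquinta1984, Ch. III §2 p.77] -/
theorem twisted_stability_caccioppoli_ball [DecidableEq (PBond P j)] (T : Finset (PBond P j)) (u : Site P j → Fin 4 → ℝ)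
    (hu : ∀ x, dotProduct (u x) (u x) = 1)
    (S : PBond P j → Matrix (Fin 4) (Fin 4) ℝ) (hS : ∀ b ∈ T, S b * (S b)ᵀ = 1)
    (c : Site P j) (r : ℕ) {s : ℕ} (hs : 1 ≤ s) {τ : ℝ}
    (hτ : ∀ b ∈ T, b.src ∈ ball c (r + s) → b.tgt ∈ ball c (r + s) →
      ∑ a : Fin 4, ∑ i : Fin 4, (S b a i - (1 : Matrix (Fin 4) (Fin 4) ℝ) a i) ^ 2 ≤ τ ^ 2)
    (hmin : ∀ η : Site P j → ℝ, (∀ y, y ∉ ball c (r + s) → η y = 0) → ∀ (a : Fin 4) (t : ℝ),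
      ∑ b ∈ T, dotProduct
        ((Real.sqrt (1 + t ^ 2 * dotProduct (η b.src • (Pi.single a 1 - dotProduct (Pi.single a 1) (u b.src) • u b.src))
            (η b.src • (Pi.single a 1 - dotProduct (Pi.single a 1) (u b.src) • u b.src))))⁻¹ •
          (u b.src + t • (η b.src • (Pi.single a 1 - dotProduct (Pi.single a 1) (u b.src) • u b.src))))
        ((S b)ᵀ *ᵥ ((Real.sqrt (1 + t ^ 2 * dotProduct (η b.tgt • (Pi.single a 1 - dotProduct (Pi.single a 1) (u b.tgt) • u b.tgt))
            (η b.tgt • (Pi.single a 1 - dotProduct (Pi.single a 1) (u b.tgt) • u b.tgt))))⁻¹ •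
          (u b.tgt + t • (η b.tgt • (Pi.single a 1 - dotProduct (Pi.single a 1) (u b.tgt) • u b.tgt))))) ≤
      ∑ b ∈ T, dotProduct (u b.src) ((S b)ᵀ *ᵥ u b.tgt)) :
    ∑ b ∈ T.filter (fun b => b.src ∈ ball c r ∧ b.tgt ∈ ball c r),
      dotProduct (u b.src - (S b)ᵀ *ᵥ u b.tgt) (u b.src - (S b)ᵀ *ᵥ u b.tgt) *
        (1 + dotProduct (u b.src - (S b)ᵀ *ᵥ u b.tgt) (u b.src - (S b)ᵀ *ᵥ u b.tgt)) ≤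
      6 * (2 * (P.d : ℝ) * ((2 * (r + s) + 1 : ℕ) : ℝ) ^ P.d) * (1 / (s : ℝ) ^ 2 + τ ^ 2) := by
  classical
  obtain ⟨χ, hχ0, hχ1, hχin, hχout, hχlip⟩ := exists_tdist_cutoff c r hs
  have hχout' : ∀ y, y ∉ ball c (r + s) → χ y = 0 := fun y hy => hχout y (by rw [mem_ball, not_le] at hy; omega)
  have hG := twisted_graph_stability_frob (B := ↥T) (fun b => b.1.src) (fun b => b.1.tgt) u hu
    (fun b => S b.1) (fun b => hS b.1 b.2) χ hχ0 (fun a t => by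
    have h := hmin χ hχout' a t
    rw [← Finset.sum_coe_sort T] at h
    rw [← Finset.sum_coe_sort T] at h
    exact h)
  rw [Finset.sum_coe_sort T (fun b => χ b.src * χ b.tgt *
      dotProduct (u b.src - (S b)ᵀ *ᵥ u b.tgt) (u b.src - (S b)ᵀ *ᵥ u b.tgt) *
        (1 + dotProduct (u b.src - (S b)ᵀ *ᵥ u b.tgt) (u b.src - (S b)ᵀ *ᵥ u b.tgt))),
    Finset.sum_coe_sort T (fun b => dotProduct (u b.src) ((S b)ᵀ *ᵥ u b.tgt) * (χ b.src - χ b.tgt) ^ 2 +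
      χ b.src * χ b.tgt * ∑ a : Fin 4, ∑ i : Fin 4, (S b a i - (1 : Matrix (Fin 4) (Fin 4) ℝ) a i) ^ 2)] at hG
  have he0 : ∀ b : PBond P j, 0 ≤ dotProduct (u b.src - (S b)ᵀ *ᵥ u b.tgt) (u b.src - (S b)ᵀ *ᵥ u b.tgt) := fun b => by
    simp only [dotProduct, Pi.sub_apply]
    exact Finset.sum_nonneg fun i _ => mul_self_nonneg _
  have hterm0 : ∀ b : PBond P j, 0 ≤ dotProduct (u b.src - (S b)ᵀ *ᵥ u b.tgt) (u b.src - (S b)ᵀ *ᵥ u b.tgt) *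
      (1 + dotProduct (u b.src - (S b)ᵀ *ᵥ u b.tgt) (u b.src - (S b)ᵀ *ᵥ u b.tgt)) := fun b =>
    mul_nonneg (he0 b) (by linarith [he0 b])
  have hL : ∑ b ∈ T.filter (fun b => b.src ∈ ball c r ∧ b.tgt ∈ ball c r),
      dotProduct (u b.src - (S b)ᵀ *ᵥ u b.tgt) (u b.src - (S b)ᵀ *ᵥ u b.tgt) *
        (1 + dotProduct (u b.src - (S b)ᵀ *ᵥ u b.tgt) (u b.src - (S b)ᵀ *ᵥ u b.tgt)) ≤
      ∑ b ∈ T, χ b.src * χ b.tgt * dotProduct (u b.src - (S b)ᵀ *ᵥ u b.tgt) (u b.src - (S b)ᵀ *ᵥ u b.tgt) *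
        (1 + dotProduct (u b.src - (S b)ᵀ *ᵥ u b.tgt) (u b.src - (S b)ᵀ *ᵥ u b.tgt)) := by
    calc ∑ b ∈ T.filter (fun b => b.src ∈ ball c r ∧ b.tgt ∈ ball c r),
          dotProduct (u b.src - (S b)ᵀ *ᵥ u b.tgt) (u b.src - (S b)ᵀ *ᵥ u b.tgt) *
            (1 + dotProduct (u b.src - (S b)ᵀ *ᵥ u b.tgt) (u b.src - (S b)ᵀ *ᵥ u b.tgt))
        = ∑ b ∈ T.filter (fun b => b.src ∈ ball c r ∧ b.tgt ∈ ball c r), χ b.src * χ b.tgt *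
            dotProduct (u b.src - (S b)ᵀ *ᵥ u b.tgt) (u b.src - (S b)ᵀ *ᵥ u b.tgt) *
              (1 + dotProduct (u b.src - (S b)ᵀ *ᵥ u b.tgt) (u b.src - (S b)ᵀ *ᵥ u b.tgt)) := by
          refine Finset.sum_congr rfl fun b hb => ?_
          obtain ⟨_, hb1, hb2⟩ := Finset.mem_filter.1 hb
          rw [hχin _ (mem_ball.1 hb1), hχin _ (mem_ball.1 hb2), one_mul, one_mul]
      _ ≤ _ := by
          refine Finset.sum_le_sum_of_subset_of_nonneg (Finset.filter_subset _ T) fun b _ _ => ?_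
          rw [mul_assoc]
          exact mul_nonneg (mul_nonneg (hχ0 _) (hχ0 _)) (hterm0 b)
  have hR1 : ∑ b ∈ T, dotProduct (u b.src) ((S b)ᵀ *ᵥ u b.tgt) * (χ b.src - χ b.tgt) ^ 2 ≤
      2 * (P.d : ℝ) * ((2 * (r + s) + 1 : ℕ) : ℝ) ^ P.d / (s : ℝ) ^ 2 :=
    sum_sq_sub_tdist_cutoff_le T c (r + s) hs hχout' hχlip (fun b => dotProduct (u b.src) ((S b)ᵀ *ᵥ u b.tgt))
      (fun b hb => dot_le_one (hu _) (by rw [transpose_mulVec_dot (hS b hb), hu]))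
  have hR2 : ∑ b ∈ T, χ b.src * χ b.tgt * ∑ a : Fin 4, ∑ i : Fin 4, (S b a i - (1 : Matrix (Fin 4) (Fin 4) ℝ) a i) ^ 2 ≤
      2 * (P.d : ℝ) * ((2 * (r + s) + 1 : ℕ) : ℝ) ^ P.d * τ ^ 2 := by
    have hF0 : ∀ b : PBond P j, 0 ≤ ∑ a : Fin 4, ∑ i : Fin 4, (S b a i - (1 : Matrix (Fin 4) (Fin 4) ℝ) a i) ^ 2 := fun b =>
      Finset.sum_nonneg fun a _ => Finset.sum_nonneg fun i _ => sq_nonneg _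
    rw [← Finset.sum_filter_add_sum_filter_not T (fun b => b.src ∈ ball c (r + s) ∨ b.tgt ∈ ball c (r + s))]
    have hzero : ∑ b ∈ T.filter (fun b => ¬(b.src ∈ ball c (r + s) ∨ b.tgt ∈ ball c (r + s))),
        χ b.src * χ b.tgt * ∑ a : Fin 4, ∑ i : Fin 4, (S b a i - (1 : Matrix (Fin 4) (Fin 4) ℝ) a i) ^ 2 = 0 := by
      refine Finset.sum_eq_zero fun b hb => ?_
      rw [Finset.mem_filter, not_or] at hb
      rw [hχout' _ hb.2.1, zero_mul, zero_mul]
    rw [hzero, add_zero]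
    have hterm : ∀ b ∈ T.filter (fun b => b.src ∈ ball c (r + s) ∨ b.tgt ∈ ball c (r + s)),
        χ b.src * χ b.tgt * ∑ a : Fin 4, ∑ i : Fin 4, (S b a i - (1 : Matrix (Fin 4) (Fin 4) ℝ) a i) ^ 2 ≤ τ ^ 2 := by
      intro b hb
      have hbT := (Finset.mem_filter.1 hb).1
      by_cases hboth : b.src ∈ ball c (r + s) ∧ b.tgt ∈ ball c (r + s)
      · have hF := hτ b hbT hboth.1 hboth.2
        have hχχ : χ b.src * χ b.tgt ≤ 1 := by
          calc χ b.src * χ b.tgt ≤ 1 * 1 := mul_le_mul (hχ1 _) (hχ1 _) (hχ0 _) zero_le_one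
            _ = 1 := one_mul 1
        calc χ b.src * χ b.tgt * ∑ a : Fin 4, ∑ i : Fin 4, (S b a i - (1 : Matrix (Fin 4) (Fin 4) ℝ) a i) ^ 2
            ≤ 1 * τ ^ 2 := mul_le_mul hχχ hF (hF0 b) zero_le_one
          _ = τ ^ 2 := one_mul _
      · rw [not_and_or] at hboth
        rcases hboth with h1 | h2
        · rw [hχout' _ h1, zero_mul, zero_mul]; exact sq_nonneg τ
        · rw [hχout' _ h2, mul_zero, zero_mul]; exact sq_nonneg τ
    calc ∑ b ∈ T.filter (fun b => b.src ∈ ball c (r + s) ∨ b.tgt ∈ ball c (r + s)),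
          χ b.src * χ b.tgt * ∑ a : Fin 4, ∑ i : Fin 4, (S b a i - (1 : Matrix (Fin 4) (Fin 4) ℝ) a i) ^ 2
        ≤ ∑ _b ∈ T.filter (fun b => b.src ∈ ball c (r + s) ∨ b.tgt ∈ ball c (r + s)), τ ^ 2 := Finset.sum_le_sum hterm
      _ = ((T.filter fun b => b.src ∈ ball c (r + s) ∨ b.tgt ∈ ball c (r + s)).card : ℝ) * τ ^ 2 := by
          rw [Finset.sum_const, nsmul_eq_mul]
      _ ≤ 2 * (P.d : ℝ) * ((2 * (r + s) + 1 : ℕ) : ℝ) ^ P.d * τ ^ 2 :=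
          mul_le_mul_of_nonneg_right (card_touching_ball_le T c (r + s)) (sq_nonneg τ)
  rw [Finset.sum_add_distrib] at hG
  calc _ ≤ _ := hL
    _ ≤ _ := hG
    _ ≤ 6 * (2 * (P.d : ℝ) * ((2 * (r + s) + 1 : ℕ) : ℝ) ^ P.d / (s : ℝ) ^ 2 +
          2 * (P.d : ℝ) * ((2 * (r + s) + 1 : ℕ) : ℝ) ^ P.d * τ ^ 2) := by linarith
    _ = 6 * (2 * (P.d : ℝ) * ((2 * (r + s) + 1 : ℕ) : ℝ) ^ P.d) * (1 / (s : ℝ) ^ 2 + τ ^ 2) := by ring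

end Summit.QuantumFields.YangMills.Theorems.PoincareLipschitzLeungXinBallCaccioppoliTorus
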